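import Summits.BirchSwinnertonDyer.Rank1Residual.X11b.Three.LambdaSupplyTwistFamily
import Summits.BirchSwinnertonDyer.Rank1Residual.X11b.Three.LambdaSupplyTwistSupply
import Literature.NumberTheory.GaloisRepresentations.HeckeCharacterAutConj
import HarnessLib

/-!
# X11b @ `p = 3`, S29 (the (n2)-by-values road), K1: GALOIS TRANSPORT ON THE INTERPOLATION RANGE

HONEST FRAMING (cell `b2b-bsdres`, run/shared/lean/b2b/bsd-rank1-residual/, verbatim in every
file): the goal of the cell is to DELETE the COMBINATION-SHAPED residual classes of the
Birch–Swinnerton-Dyer formula for ALL analytic-rank `≤ 1` elliptic curves over `ℚ` — assembled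
STRICTLY from published theorems — so that the rank-`≤ 1` remainder becomes exactly the
CONSTRUCTION-SHAPED classes, which are TYPED, NOT attempted. This is not "finishing BSD". Team N8/O2
(X11b at `3`: `3 ‖ N`, `r_an = 1`, `E[3]` irreducible); deal S29 (x11b3-lead GEN 8, OWNERS R9-8),
package K1, seat `b2b-bsdres-x11b3-p7` (gen. 5). WORDING OF RECORD (H45, R9-8): S29 RE-EXPRESSES
(t) ⟸ (VR); this file is an UNCONDITIONAL kernel lemma (CM-character transport) and SUPPLIES
NOTHING of the class record by itself; the node `Three.HsiehDescentAt₃` is UNCHANGED; O2 OPEN /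
N8 CONSTRUCTION; nothing booked. THEOREMS ONLY (no definition, no named fact, no `sorry`); valid at
every prime `p` and every number field where stated.

## What this file proves

The interpolation RANGE of the tree's `IsHsiehLFunction` / `IsBDPLFunction` at a datum
`(ι : ℚ̄_p ≃ ℂ, K, κ, γ)` is the set of triples `(χ, n, r)`: `χ` a Hecke character of `K`
UNRAMIFIED at every finite place, of infinity type `(n, −n)` (`HasInfinityType (n) (−n)`), `r` a
`p`-adic avatar of `χ` (`IsPAdicAvatarOf ι χ r`) factoring through `κ` (`FactorsThroughZp κ r`);
the interpolation point is `r(γ) − 1` (`avatarValueAt`). Let `τ` be a CONTINUOUS ring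
automorphism of `ℚ̄_p = PadicAlgCl p` and `σ ∈ Aut(ℂ)` its transport `σ ∘ ι = ι ∘ τ`.

* §1 `autConjType_eq_of_forall_apply_eq` — if `σ` fixes every complex embedding of `K`
  pointwise and `K` has no real place, Weil's conjugate type `^σ(p, q)` (tree
  `HeckeCharacter.autConjType`, `HeckeCharacterAutConj.lean`) is `(p, q)`; hence
  `hasInfinityType_autConj_of_forall_apply_eq`: `^σχ` has the SAME infinity type as `χ`.
* §2 `isPAdicAvatarOf_autConj_unitsChar` — if `e ∘ ψ` is the avatar of `χ` then `e ∘ (τ ∘ ψ)` is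
  the avatar of Weil's conjugate `^σχ` (tree `HasInfinityType.autConj`: `(^σχ)(ϖ_v) = σ(χ(ϖ_v))`);
  `factorsThroughZp_map_unitsChar`, `avatarValueAt_map_unitsChar` (the point moves by `τ`).
* §3 `range_transport` — THE RANGE IS `Aut(ℚ̄_p/·)`-STABLE: `(χ, n, r) ↦ (^σχ, n, τ ∘ r)`, with
  `(^σχ)(ϖ_v) = σ(χ(ϖ_v))`, `^σχ = σ ∘ χ` on the finite ideles, and the new point `τ(r(γ))`.
* §4 `exists_pow_div_eq_one_of_transport` — `^σχ = χ · μ` with `μ` unramified of type `(0,0)`,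
  hence of FINITE ORDER (tree `stub_isFiniteOrder_of_hasInfinityType_zero`), and through `κ`, hence
  of `p`-power order: `∃ k, (τ(ψ σ)/ψ σ)^{p^k} = 1` for all `σ` — so `τ(u)/u` is a `p`-power root of
  unity for every value `u` of the avatar (lit1's `k(K,p)` phenomenon, LIT-TABLE L59).

References: [Weil1956] §1; [Hsieh2014] p. 3 ll. 28–32 (the locally algebraic characters `𝔛` on
`Γ⁻`); cell files `cells/x11b3/OWNERS.md` R9-8, memo `HOME/b2b-bsdres-x11b3-p7/s25/S29-SIGMA-VALUES-ROAD.md` §1 (G).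
-/

noncomputable section

open scoped NumberField
open NumberField IsDedekindDomain Field
open Literature.NumberTheory.GaloisRepresentations Literature.NumberTheory.EllipticCurves
open Summit.BirchSwinnertonDyer.Rank1Residual.X11b.Three.LambdaSupply

namespace Summit.BirchSwinnertonDyer.Rank1Residual.X11b.Three.RangeTransport

universe u

/-! ### §1. An automorphism fixing the embeddings preserves the infinity type -/

section InfinityType

variable {K : Type u} [Field K] [NumberField K]

omit [NumberField K] in
/-- **If `σ ∈ Aut(ℂ)` fixes every complex embedding of `K` pointwise and `K` has no real place,
then Weil's conjugate type `^σ(p, q)` equals `(p, q)`** (the exponent of `φ` in `^σ(p,q)` is that of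
`σ⁻¹ ∘ φ = φ`; at a complex place `w` the two embeddings `σ_w`, `σ̄_w` carry `p_w`, `q_w`).
[cite: Weil1956, §1] -/
theorem autConjType_eq_of_forall_apply_eq (σ : ℂ ≃ₐ[ℚ] ℂ)
    (hσ : ∀ (φ : K →+* ℂ) (k : K), σ (φ k) = φ k) (hK : ∀ w : InfinitePlace K, ¬ w.IsReal)
    (p q : InfinitePlace K → ℤ) : HeckeCharacter.autConjType σ p q = (p, q) := by
  have hcomp : ∀ φ : K →+* ℂ, (σ.symm : ℂ ≃ₐ[ℚ] ℂ).toAlgHom.toRingHom.comp φ = φ := by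
    intro φ
    ext k
    change σ.symm (φ k) = φ k
    conv_lhs => rw [← hσ φ k]
    exact σ.symm_apply_apply (φ k)
  unfold HeckeCharacter.autConjType HeckeCharacter.typeOfExponent
  simp only [hcomp]
  have hreal : ∀ w : InfinitePlace K, ¬ ComplexEmbedding.IsReal w.embedding := fun w h ↦
    hK w (InfinitePlace.isReal_iff.mpr h)
  ext w
  · simp only [HeckeCharacter.embExponent, if_neg (hreal w), InfinitePlace.mk_embedding, if_true]
  · have h1 : ¬ ComplexEmbedding.IsReal (ComplexEmbedding.conjugate w.embedding) := by
      rw [ComplexEmbedding.isReal_conjugate_iff]; exact hreal w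
    have h2 : ComplexEmbedding.conjugate w.embedding ≠ w.embedding := fun h ↦
      hreal w (ComplexEmbedding.isReal_iff.mpr h)
    simp only [if_neg (hK w), HeckeCharacter.embExponent, if_neg h1]
    rw [InfinitePlace.mk_conjugate_eq, InfinitePlace.mk_embedding, if_neg h2]

/-- **`^σχ` has the same infinity type as `χ`** when `σ` fixes the embeddings of `K` and `K` has no
real place (e.g. `K` imaginary quadratic and `σ` fixing `K ⊂ ℂ`). [cite: Weil1956, §1] -/
theorem hasInfinityType_autConj_of_forall_apply_eq {χ : HeckeCharacter K}
    {p q : InfinitePlace K → ℤ} (h : χ.HasInfinityType p q) (σ : ℂ ≃ₐ[ℚ] ℂ)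
    (hσ : ∀ (φ : K →+* ℂ) (k : K), σ (φ k) = φ k) (hK : ∀ w : InfinitePlace K, ¬ w.IsReal) :
    (h.autConj σ).HasInfinityType p q := by
  have := h.hasInfinityType_autConj σ
  rwa [autConjType_eq_of_forall_apply_eq σ hσ hK] at this

/-- An imaginary quadratic field has no real place. [folklore] -/
theorem not_isReal_of_isImaginaryQuadratic (hK : IsImaginaryQuadratic K) (w : InfinitePlace K) :
    ¬ w.IsReal := by
  haveI : IsTotallyComplex K := hK.2
  exact InfinitePlace.not_isReal_iff_isComplex.mpr (IsTotallyComplex.isComplex w)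

/-- Every ring automorphism of `ℂ` is a `ℚ`-algebra automorphism (the form `ℂ ≃ₐ[ℚ] ℂ` in which
the tree's `HasInfinityType.autConj` takes its `σ`): for `e : ℂ ≃+* ℂ` there is `σ` with
`σ z = e z` for all `z`. [folklore] -/
theorem exists_algEquiv_eq_ringEquiv (e : ℂ ≃+* ℂ) : ∃ σ : ℂ ≃ₐ[ℚ] ℂ, ∀ z, σ z = e z :=
  ⟨AlgEquiv.ofRingEquiv (f := e) fun r ↦ by simp, fun _ ↦ rfl⟩

end InfinityType

/-! ### §2. Transport of the avatar along a continuous automorphism of `ℚ̄_p` -/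

section Avatar

variable {K : Type} [Field K] [NumberField K] {p : ℕ} [Fact p.Prime]

/-- The continuous automorphism `τ` of `ℚ̄_p` on the units, as a continuous character of `ℚ̄_pˣ`
(auxiliary term, inlined in the statements below through `Units.map`). [folklore] -/
theorem continuous_unitsMap (τ : PadicAlgCl p ≃+* PadicAlgCl p) (hτ : Continuous τ) :
    Continuous (Units.map (τ : PadicAlgCl p →* PadicAlgCl p)) :=
  Continuous.units_map _ hτ

/-- `ι⁻¹ ∘ σ = τ ∘ ι⁻¹` when `σ ∘ ι = ι ∘ τ`. [folklore] -/
theorem symm_apply_eq_of_transport (ι : PadicAlgCl p ≃+* ℂ) (τ : PadicAlgCl p ≃+* PadicAlgCl p)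
    (σ : ℂ ≃ₐ[ℚ] ℂ) (hστ : ∀ z : PadicAlgCl p, σ (ι z) = ι (τ z)) (x : ℂ) :
    ι.symm (σ x) = τ (ι.symm x) := by
  apply ι.injective
  rw [ι.apply_symm_apply, ← hστ, ι.apply_symm_apply]

/-- **Transport of the avatar condition (plain characters).** If `ψ : Γ_K → ℚ̄_pˣ` satisfies the
avatar condition of `χ` w.r.t. `ι` (kills inertia above every `v ∤ p` where `χ` is unramified and
`ψ(Φ) = ι⁻¹(χ(ϖ_v))⁻¹` at the arithmetic Frobenii), then `τ ∘ ψ` satisfies it for Weil's conjugate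
`^σχ` (`(^σχ)(ϖ_v) = σ(χ(ϖ_v))`, `^σχ` unramified at `v` iff `χ` is), for `σ ∘ ι = ι ∘ τ`.
[cite: Weil1956, §1] [cite: CastellaHsieh2018, §3.3 (p. 9) (the avatar dictionary)] -/
theorem isPAdicAvatarOf_autConj_unitsChar (ι : PadicAlgCl p ≃+* ℂ)
    (τ : PadicAlgCl p ≃+* PadicAlgCl p) (hτ : Continuous τ) (σ : ℂ ≃ₐ[ℚ] ℂ)
    (hστ : ∀ z : PadicAlgCl p, σ (ι z) = ι (τ z))
    {χ : HeckeCharacter K} {pp qq : InfinitePlace K → ℤ} (h : χ.HasInfinityType pp qq)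
    {ψ : absoluteGaloisGroup K →ₜ* (PadicAlgCl p)ˣ}
    (hψ : IsPAdicAvatarOf ι χ ((FramedRep.unitsContinuousMulEquivOfUnique (Fin 1) (PadicAlgCl p) :
      (PadicAlgCl p)ˣ →ₜ* GL (Fin 1) (PadicAlgCl p)).comp ψ)) :
    IsPAdicAvatarOf ι (h.autConj σ) ((FramedRep.unitsContinuousMulEquivOfUnique (Fin 1) (PadicAlgCl p) :
      (PadicAlgCl p)ˣ →ₜ* GL (Fin 1) (PadicAlgCl p)).comp
      ((ContinuousMonoidHom.mk (Units.map (τ : PadicAlgCl p →* PadicAlgCl p))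
        (continuous_unitsMap τ hτ)).comp ψ)) := by
  rw [isPAdicAvatarOf_unitsChar_iff] at hψ ⊢
  intro v hv hunr'
  have hunr : χ.IsUnramifiedAt v := (h.isUnramifiedAt_autConj_iff σ v).mp hunr'
  obtain ⟨hI, hF⟩ := hψ v hv hunr
  refine ⟨fun 𝔓 h𝔓 g hg ↦ ?_, fun 𝔓 h𝔓 Φ hΦ ↦ ?_⟩
  · change Units.map (τ : PadicAlgCl p →* PadicAlgCl p) (ψ g) = 1
    rw [hI 𝔓 h𝔓 g hg, map_one]
  · rw [h.valueAtUniformizer_autConj, symm_apply_eq_of_transport ι τ σ hστ]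
    change ((Units.map (τ : PadicAlgCl p →* PadicAlgCl p) (ψ Φ) : (PadicAlgCl p)ˣ) :
      PadicAlgCl p) = _
    rw [Units.coe_map, MonoidHom.coe_coe, hF 𝔓 h𝔓 Φ hΦ, map_inv₀]

omit [NumberField K] in
/-- `τ ∘ ψ` factors through `κ` when `ψ` does. [folklore] -/
theorem factorsThroughZp_map_unitsChar (τ : PadicAlgCl p ≃+* PadicAlgCl p) (hτ : Continuous τ)
    (κ : ZpExtension K p) {ψ : absoluteGaloisGroup K →ₜ* (PadicAlgCl p)ˣ}
    (hψ : FactorsThroughZp κ ((FramedRep.unitsContinuousMulEquivOfUnique (Fin 1) (PadicAlgCl p) :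
      (PadicAlgCl p)ˣ →ₜ* GL (Fin 1) (PadicAlgCl p)).comp ψ)) :
    FactorsThroughZp κ ((FramedRep.unitsContinuousMulEquivOfUnique (Fin 1) (PadicAlgCl p) :
      (PadicAlgCl p)ˣ →ₜ* GL (Fin 1) (PadicAlgCl p)).comp
      ((ContinuousMonoidHom.mk (Units.map (τ : PadicAlgCl p →* PadicAlgCl p))
        (continuous_unitsMap τ hτ)).comp ψ)) := by
  rw [factorsThroughZp_unitsChar_iff] at hψ ⊢
  intro g hg
  change Units.map (τ : PadicAlgCl p →* PadicAlgCl p) (ψ g) = 1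
  rw [hψ g hg, map_one]

omit [NumberField K] in
/-- **The interpolation point moves by `τ`**: the value at `γ` of `e ∘ (τ ∘ ψ)` is `τ(ψ(γ))`.
[folklore] -/
theorem avatarValueAt_map_unitsChar (τ : PadicAlgCl p ≃+* PadicAlgCl p) (hτ : Continuous τ)
    (ψ : absoluteGaloisGroup K →ₜ* (PadicAlgCl p)ˣ) (γ : absoluteGaloisGroup K) :
    avatarValueAt ((FramedRep.unitsContinuousMulEquivOfUnique (Fin 1) (PadicAlgCl p) :
      (PadicAlgCl p)ˣ →ₜ* GL (Fin 1) (PadicAlgCl p)).comp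
      ((ContinuousMonoidHom.mk (Units.map (τ : PadicAlgCl p →* PadicAlgCl p))
        (continuous_unitsMap τ hτ)).comp ψ)) γ =
      ((τ ((ψ γ : (PadicAlgCl p)ˣ) : PadicAlgCl p) : PadicAlgCl p) : ℂ_[p]) := by
  rw [avatarValueAt_unitsChar]
  rfl

end Avatar

/-! ### §3. The RANGE is stable under transport -/

section Range

variable {K : Type} [Field K] [NumberField K] {p : ℕ} [Fact p.Prime]

/-- **Galois transport on the interpolation RANGE.** Let `τ` be a continuous automorphism of
`ℚ̄_p`, `σ ∈ Aut(ℂ)` with `σ ∘ ι = ι ∘ τ` fixing the complex embeddings of `K` pointwise, `K`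
without real places. If `χ` is unramified at every finite place, of infinity type `(n, −n)`, with
`p`-adic avatar `r` through `κ`, then Weil's conjugate `χ' = ^σχ` is unramified at every finite
place, of infinity type `(n, −n)`, with values `χ'(ϖ_v) = σ(χ(ϖ_v))` (and `χ' = σ ∘ χ` on the
ideles with trivial infinite part), and has a `p`-adic avatar `r'` through `κ` whose values are
`τ(r(g))`: `avatarValueAt r' g = τ(det r(g))` — the interpolation point `r(γ) − 1` moves to
`τ(r(γ)) − 1`. [cite: Weil1956, §1] [cite: Hsieh2014, p. 3 ll. 28–32 (the range 𝔛)] -/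
theorem range_transport (ι : PadicAlgCl p ≃+* ℂ) (τ : PadicAlgCl p ≃+* PadicAlgCl p)
    (hτ : Continuous τ) (σ : ℂ ≃ₐ[ℚ] ℂ) (hστ : ∀ z : PadicAlgCl p, σ (ι z) = ι (τ z))
    (hσK : ∀ (φ : K →+* ℂ) (k : K), σ (φ k) = φ k) (hK : ∀ w : InfinitePlace K, ¬ w.IsReal)
    {χ : HeckeCharacter K} {n : ℤ} (hunr : ∀ v : HeightOneSpectrum (𝓞 K), χ.IsUnramifiedAt v)
    (hinf : χ.HasInfinityType (fun _ ↦ n) (fun _ ↦ -n))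
    {r : FramedGaloisRep K (PadicAlgCl p) 1} (hr : IsPAdicAvatarOf ι χ r)
    (κ : ZpExtension K p) (hκ : FactorsThroughZp κ r) :
    ∃ (χ' : HeckeCharacter K) (r' : FramedGaloisRep K (PadicAlgCl p) 1),
      (∀ v : HeightOneSpectrum (𝓞 K), χ'.IsUnramifiedAt v) ∧
      χ'.HasInfinityType (fun _ ↦ n) (fun _ ↦ -n) ∧
      (∀ v : HeightOneSpectrum (𝓞 K), χ'.valueAtUniformizer v = σ (χ.valueAtUniformizer v)) ∧
      (∀ x : ideleGroup K, (x : AdeleRing (𝓞 K) K).1 = 1 → (χ' x : ℂ) = σ (χ x : ℂ)) ∧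
      IsPAdicAvatarOf ι χ' r' ∧ FactorsThroughZp κ r' ∧
      ∀ g : absoluteGaloisGroup K,
        Matrix.GeneralLinearGroup.det (r' g) =
          Units.map (τ : PadicAlgCl p →* PadicAlgCl p) (Matrix.GeneralLinearGroup.det (r g)) ∧
        avatarValueAt r' g =
          ((τ ((Matrix.GeneralLinearGroup.det (r g) : (PadicAlgCl p)ˣ) : PadicAlgCl p) :
            PadicAlgCl p) : ℂ_[p]) := by
  -- `r = e ∘ ψ`
  set e := (FramedRep.unitsContinuousMulEquivOfUnique (Fin 1) (PadicAlgCl p) :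
    (PadicAlgCl p)ˣ →ₜ* GL (Fin 1) (PadicAlgCl p)) with he
  set ψ : absoluteGaloisGroup K →ₜ* (PadicAlgCl p)ˣ :=
    ((FramedRep.unitsContinuousMulEquivOfUnique (Fin 1) (PadicAlgCl p)).symm :
      GL (Fin 1) (PadicAlgCl p) →ₜ* (PadicAlgCl p)ˣ).comp r with hψ
  have hre : e.comp ψ = r := by rw [he, hψ, comp_symm_comp_eq]
  have hr' : IsPAdicAvatarOf ι χ (e.comp ψ) := by rwa [hre]
  have hκ' : FactorsThroughZp κ (e.comp ψ) := by rwa [hre]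
  set τu : (PadicAlgCl p)ˣ →ₜ* (PadicAlgCl p)ˣ :=
    ContinuousMonoidHom.mk (Units.map (τ : PadicAlgCl p →* PadicAlgCl p))
      (continuous_unitsMap τ hτ) with hτu
  refine ⟨hinf.autConj σ, e.comp (τu.comp ψ), fun v ↦ (hinf.isUnramifiedAt_autConj_iff σ v).mpr (hunr v),
    hasInfinityType_autConj_of_forall_apply_eq hinf σ hσK hK,
    fun v ↦ hinf.valueAtUniformizer_autConj σ v, fun x hx ↦ hinf.autConj_apply_of_fst_eq_one σ hx,
    isPAdicAvatarOf_autConj_unitsChar ι τ hτ σ hστ hinf hr',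
    factorsThroughZp_map_unitsChar τ hτ κ hκ', fun g ↦ ⟨?_, ?_⟩⟩
  · -- determinants
    have hdet : ∀ (φ : absoluteGaloisGroup K →ₜ* (PadicAlgCl p)ˣ) (g : absoluteGaloisGroup K),
        Matrix.GeneralLinearGroup.det (e.comp φ g) = φ g := fun φ g ↦ by
      apply Units.ext
      rw [Matrix.GeneralLinearGroup.val_det_apply, Matrix.det_fin_one]
      exact unitsChar_apply_coe φ g
    rw [hdet, ← hre, hdet]
    rfl
  · rw [avatarValueAt_map_unitsChar τ hτ ψ g, ← hre]
    congr 2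
    apply congrArg
    have : Matrix.GeneralLinearGroup.det (e.comp ψ g) = ψ g := by
      apply Units.ext
      rw [Matrix.GeneralLinearGroup.val_det_apply, Matrix.det_fin_one]
      exact unitsChar_apply_coe ψ g
    rw [this]

end Range


/-! ### §4. `^σχ = χ · μ` with `μ` of `p`-power order: `τ(u)/u` is a `p`-power root of unity -/

section Torsion

variable {K : Type} [Field K] [NumberField K] {p : ℕ} [Fact p.Prime]

/-- **The ratio of the transported avatar to the avatar has `p`-power order.** With the data of
`isPAdicAvatarOf_autConj_unitsChar` for a character `χ` UNRAMIFIED EVERYWHERE whose avatar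
`e ∘ ψ` factors through `κ`, and `σ` fixing the embeddings of `K` (no real place): the quotient
`μ = ^σχ · χ⁻¹` is unramified everywhere of infinity type `(0,0)`, hence of FINITE order (tree
`stub_isFiniteOrder_of_hasInfinityType_zero`, Neukirch VII (6.9)/(6.14)), with avatar
`e ∘ ((τ ∘ ψ) ψ⁻¹)` through `κ ≃ ℤ_p`, hence of `p`-POWER order (`exists_pow_prime_pow_eq_one`), and by
rigidity of avatars `((τ ∘ ψ) ψ⁻¹)^{p^k} = 1`: for every `g`, `(τ(ψ g) · (ψ g)⁻¹)^{p^k} = 1` — the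
values of the avatar move under `τ` by `p`-power roots of unity only (lit1 LIT-TABLE L59: the
`k(K,p)` phenomenon). [cite: Weil1956, §1] [cite: NeukirchANT1999, Ch. VII §6 Prop. (6.9) and Cor. (6.14)] -/
theorem exists_pow_map_div_eq_one (ι : PadicAlgCl p ≃+* ℂ) (τ : PadicAlgCl p ≃+* PadicAlgCl p)
    (hτ : Continuous τ) (σ : ℂ ≃ₐ[ℚ] ℂ) (hστ : ∀ z : PadicAlgCl p, σ (ι z) = ι (τ z))
    (hσK : ∀ (φ : K →+* ℂ) (k : K), σ (φ k) = φ k) (hK : ∀ w : InfinitePlace K, ¬ w.IsReal)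
    {χ : HeckeCharacter K} {n : ℤ} (hunr : ∀ v : HeightOneSpectrum (𝓞 K), χ.IsUnramifiedAt v)
    (hinf : χ.HasInfinityType (fun _ ↦ n) (fun _ ↦ -n))
    {ψ : absoluteGaloisGroup K →ₜ* (PadicAlgCl p)ˣ}
    (hψ : IsPAdicAvatarOf ι χ ((FramedRep.unitsContinuousMulEquivOfUnique (Fin 1) (PadicAlgCl p) :
      (PadicAlgCl p)ˣ →ₜ* GL (Fin 1) (PadicAlgCl p)).comp ψ))
    (κ : ZpExtension K p)
    (hκ : FactorsThroughZp κ ((FramedRep.unitsContinuousMulEquivOfUnique (Fin 1) (PadicAlgCl p) :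
      (PadicAlgCl p)ˣ →ₜ* GL (Fin 1) (PadicAlgCl p)).comp ψ)) :
    ∃ k : ℕ, ∀ g : absoluteGaloisGroup K,
      (Units.map (τ : PadicAlgCl p →* PadicAlgCl p) (ψ g) * (ψ g)⁻¹) ^ (p ^ k) = 1 := by
  set e := (FramedRep.unitsContinuousMulEquivOfUnique (Fin 1) (PadicAlgCl p) :
    (PadicAlgCl p)ˣ →ₜ* GL (Fin 1) (PadicAlgCl p)) with he
  set τu : (PadicAlgCl p)ˣ →ₜ* (PadicAlgCl p)ˣ :=
    ContinuousMonoidHom.mk (Units.map (τ : PadicAlgCl p →* PadicAlgCl p))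
      (continuous_unitsMap τ hτ) with hτu
  -- the quotient character `μ = ^σχ · χ⁻¹` and its avatar `e ∘ ((τ ∘ ψ) ψ⁻¹)`
  set μ : HeckeCharacter K := hinf.autConj σ * χ⁻¹ with hμ
  set ψμ : absoluteGaloisGroup K →ₜ* (PadicAlgCl p)ˣ := τu.comp ψ * ψ⁻¹ with hψμ
  have hunr' : ∀ v : HeightOneSpectrum (𝓞 K), (hinf.autConj σ).IsUnramifiedAt v := fun v ↦
    (hinf.isUnramifiedAt_autConj_iff σ v).mpr (hunr v)
  have hμunr : ∀ v : HeightOneSpectrum (𝓞 K), μ.IsUnramifiedAt v := fun v ↦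
    (hunr' v).mul' (hunr v).inv'
  have hμ0 : μ.HasInfinityType 0 0 := by
    have h := (hasInfinityType_autConj_of_forall_apply_eq hinf σ hσK hK).mul' hinf.inv
    convert h using 1 <;> funext w <;> simp
  have hμfin : μ.IsFiniteOrder := Summit.Langlands.Langlands.Theorems.ReciprocityUpToIrreducibility.stub_isFiniteOrder_of_hasInfinityType_zero
    K μ hμ0
  have hμav : IsPAdicAvatarOf ι μ (e.comp ψμ) := by
    rw [hμ, hψμ]
    exact isPAdicAvatarOf_mul ι (isPAdicAvatarOf_autConj_unitsChar ι τ hτ σ hστ hinf hψ)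
      (isPAdicAvatarOf_inv ι hψ)
      (hram_of_forall (fun v _ ↦ hunr' v) (fun v _ ↦ (hunr v).inv'))
  have hμκ : FactorsThroughZp κ (e.comp ψμ) := by
    rw [factorsThroughZp_unitsChar_iff]
    intro g hg
    have h1 := (factorsThroughZp_unitsChar_iff κ _).mp (factorsThroughZp_map_unitsChar τ hτ κ hκ) g hg
    have h2 := (factorsThroughZp_unitsChar_iff κ ψ).mp hκ g hg
    rw [hψμ, ContinuousMonoidHom.mul_apply, unitsChar_inv_apply, h2, inv_one, mul_one]
    exact h1
  obtain ⟨k, hk⟩ := exists_pow_prime_pow_eq_one ι hμfin (fun v _ ↦ hμunr v) hμav hμκ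
  -- rigidity: the avatar of `μ^{p^k} = 1` is trivial
  have hpow : IsPAdicAvatarOf ι (μ ^ p ^ k) (e.comp (ψμ ^ p ^ k)) :=
    isPAdicAvatarOf_pow ι hμav (fun v _ ↦ hμunr v) (p ^ k)
  rw [hk] at hpow
  have heq := eq_of_isPAdicAvatarOf ι (isPAdicAvatarOf_one (K := K) ι) hpow
  refine ⟨k, fun g ↦ ?_⟩
  have := DFunLike.congr_fun heq g
  have h1g : (1 : absoluteGaloisGroup K →ₜ* (PadicAlgCl p)ˣ) g = 1 := rfl
  rw [ContinuousMonoidHom.coe_comp, ContinuousMonoidHom.coe_comp, Function.comp_apply,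
    Function.comp_apply, ContinuousMonoidHom.pow_apply, h1g] at this
  have hval : ψμ g = Units.map (τ : PadicAlgCl p →* PadicAlgCl p) (ψ g) * (ψ g)⁻¹ := rfl
  rw [← hval]
  exact (FramedRep.unitsContinuousMulEquivOfUnique (Fin 1) (PadicAlgCl p)).injective this

end Torsion

end Summit.BirchSwinnertonDyer.Rank1Residual.X11b.Three.RangeTransport

end
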